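import Summits.Langlands.Langlands.Theses.CyclicDeinductionCarving

/-!
# Route CyclicDeinductionCarving — Assembly

The assembly item (stmt-Langlands-27506) of the child route `CyclicDeinductionCarving` (decomp-langlands lens-3 gen 17; a gate-native D-0170
refining child: `--refines route-Langlands-RootDecomp1:DarkPrimitiveAvatars`, edge split, depth 1) for the declared residual
G = `RootDecomp1.DarkPrimitiveAvatars` (stmt-Langlands-29147):
`InsolubleDarkAvatars → ConjugateUnmixing → InducedPreAvatar → AccessibleAvatars → AvatarDescent → RestrictionTwistTransport →
InductionTransport → DualTransport → RootDecomp1.DarkPrimitiveAvatars`.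

This is literally the type of the route file's sorry-free deciding theorem `Summit.Langlands.Langlands.Theses.CyclicDeinductionCarving.closes`
(minimality of the six-move special class: acc, up, down, ai, dual and the new move ai↓ = IND followed by UNMIX; complement = G⁺).  Nothing here
proves `Langlands` (nor G): the assembly records only that the route's items, taken together, imply the host residual by name.
-/

set_option linter.dupNamespace false -- project-wide option (lakefile weak.linter.dupNamespace); `Summit.Langlands.Langlands` is the mandated namespace

namespace Summit.Langlands.Langlands.Theorems

/-- **Assembly of route CyclicDeinductionCarving** (stmt-Langlands-27506): G⁺ → UNMIX → IND → Acc → AvDesc → RTT → AIT → DT → `RootDecomp1.DarkPrimitiveAvatars`.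
Proof: unfold `Assembly` and apply the route's deciding theorem `Theses.CyclicDeinductionCarving.closes`. -/
theorem cyclicDeinductionCarving_assembly_proof :
    Summit.Langlands.Langlands.Theses.CyclicDeinductionCarving.Assembly := by
  unfold Summit.Langlands.Langlands.Theses.CyclicDeinductionCarving.Assembly
  exact Summit.Langlands.Langlands.Theses.CyclicDeinductionCarving.closes

end Summit.Langlands.Langlands.Theorems
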